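/-
COR-CM (cell pub-hodgecm2, stage 2 of the Hodge ladder) — count-neutral KERNEL COMBINATORICS «the prism identity of rank-four faces and the
transport faces of an index-two extension» (seat prover-pub-hodgecm2-b23-g46-0, binder prover b23, gen 46; claim «SPLIT INDEX-TWO», HOME/INBOX.md
l.20957).  Theorems only, on top of `Census/IndexTwoSplitCirculation` BY NAME; no `decide`, no certificate, no named fact, no `sorry`;
`Interfaces.lean` (C1), every E term, B01, `Transposition/*`, `PortJoin/*`, `D2Bridge/*` untouched.
HONEST FRAMING: `HC_CM` is NOT proved, here or anywhere in the tree; nothing here is a period, a count of record or a headline.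
T5: n/a-class (hypothesis binders: `c * c = 1` only, plus the index-two setting in §2); checker: self.
-/
import Summits.HodgeConjecture.CorCM.Census.IndexTwoSplitCirculation

/-!
# The prism identity `gface Θ s t + gface Θ^{(s)} s u + gface Θ^{(t)} s u = gface Θ^{(u)} s t` and the transport faces

§1 A universal identity among rank-four faces of `(G, c)` (any `c` with `c² = 1`, any type `Θ`, any three elements `s, t, u`): the three
faces `gface Θ s t`, `gface Θ^{(s)} s u`, `gface Θ^{(t)} s u` of the prism over the edge `s` sum to the face `gface Θ^{(u)} s t` of the
opposite side (`gface_prism`; pure flip algebra: flips commute and are involutions).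

§2 Read in an index-two extension `G ⊃ H ∋ c`, `x ∉ H` (parts I–IV): for a NEIGHBOUR type `Θ = (a, a^{(k)})` and a place `l` of `H`, the
**TRANSPORT FACE** `gface Θ l (x·l)` (flip the place `l` in both coordinates) equals the TWO-CYCLE FACE `gface Θ^{(x k)} l (x·l)` at the
diagonal type `Θ^{(x k)} = (a, a)` MINUS the two mixed faces `gface Θ^{(l)} l (x·k)` and `gface Θ^{(x l)} l (x·k)` — for `l ≠ k`-place these
are distance-lowering faces at the two distance-`2` types `(a^{(l)}, a^{(k)})`, `(a, a^{(k)(l)})` (`transport_eq_twoCycle_sub_sub`).  So in the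
CHECKLIST of part IV the two-cycle obligations may be traded for transport faces modulo distance-lowering faces: this is why, numerically
(design note `HOME/pub-hodgecm2-b23/SPLIT-INDEX-TWO.md`), transports at neighbour types serve as the closing faces of the split index-two law.

## References
* [Pohlmann1968] H. Pohlmann, Algebraic cycles on abelian varieties of complex multiplication type, Ann. of Math. 88 (1968), Thm 1.
-/

namespace Summit.HodgeConjecture.CorCM.Census.IndexTwoDescent

open Finset
open Summit.HodgeConjecture.CorCM.Prior.AllgGroup.RfwfAllgGroup
open Summit.HodgeConjecture.CorCM.Census.BlockParity

noncomputable section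

variable {G : Type*} [Group G] [Fintype G] [DecidableEq G] {c : G}

/-! ## §1 The prism identity -/

/-- **THE PRISM IDENTITY**: `gface Θ s t + gface Θ^{(s)} s u + gface Θ^{(t)} s u = gface Θ^{(u)} s t` for every type `Θ` and all `s, t, u`.
[folklore] -/
theorem gface_prism (hc2 : c * c = 1) (Θ : CMF G c) (s t u : G) :
    gface c hc2 Θ s t + gface c hc2 (oflipCM c hc2 s Θ) s u + gface c hc2 (oflipCM c hc2 t Θ) s u =
      gface c hc2 (oflipCM c hc2 u Θ) s t := by
  unfold gface
  rw [oflipCM_oflipCM_comm c hc2 u s Θ]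
  simp only [oflipCM_oflipCM_self]
  rw [oflipCM_oflipCM_comm c hc2 u t Θ]
  abel

/-- The prism identity solved for the first face: `gface Θ s t = gface Θ^{(u)} s t − gface Θ^{(s)} s u − gface Θ^{(t)} s u`. [folklore] -/
theorem gface_eq_prism (hc2 : c * c = 1) (Θ : CMF G c) (s t u : G) :
    gface c hc2 Θ s t = gface c hc2 (oflipCM c hc2 u Θ) s t - gface c hc2 (oflipCM c hc2 s Θ) s u - gface c hc2 (oflipCM c hc2 t Θ) s u := by
  rw [← gface_prism hc2 Θ s t u]; abel

/-! ## §2 Transport faces of an index-two extension -/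

variable {H : Subgroup G} [DecidablePred (· ∈ H)]

omit [DecidablePred (· ∈ H)] in
/-- **TRANSPORT = TWO-CYCLE − TWO MIXED FACES**: for every type `Θ` and `k, l ∈ H`,
`gface Θ l (x·l) = gface Θ^{(x k)} l (x·l) − gface Θ^{(l)} l (x·k) − gface Θ^{(x l)} l (x·k)`; when `Θ = (a, a^{(k)})` is a neighbour type,
`Θ^{(x k)} = (a, a)` is diagonal (so the first face on the right is a two-cycle face) and, for `l` off the place of `k`, the two subtracted
faces are distance-lowering mixed faces at types of distance `2`. [folklore] -/
theorem transport_eq_twoCycle_sub_sub (hc2 : c * c = 1) (x : G) (Θ : CMF G c) (k l : H) :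
    gface c hc2 Θ (l : G) (x * (l : G)) = gface c hc2 (oflipCM c hc2 (x * (k : G)) Θ) (l : G) (x * (l : G))
      - gface c hc2 (oflipCM c hc2 (l : G) Θ) (l : G) (x * (k : G)) - gface c hc2 (oflipCM c hc2 (x * (l : G)) Θ) (l : G) (x * (k : G)) :=
  gface_eq_prism hc2 Θ (l : G) (x * (l : G)) (x * (k : G))

/-- The diagonal corner of a transport: if `res₁ Θ = (res₀ Θ)^{(k)}` (a neighbour type along `k`) then `Θ^{(x k)}` is diagonal. [folklore] -/
theorem res_oflipCM_mul_of_neighbour (hcH : c ∈ H) (hcen : ∀ g : G, g * c = c * g) (hc2 : c * c = 1) {x : G} (hx : x ∉ H) (Θ : CMF G c) (k : H)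
    (hk : res₁ hcH hcen x Θ = oflipCM (⟨c, hcH⟩ : H) (csub_mul_csub hcH hc2) k (res₀ hcH Θ)) :
    res₁ hcH hcen x (oflipCM c hc2 (x * (k : G)) Θ) = res₀ hcH (oflipCM c hc2 (x * (k : G)) Θ) := by
  rw [res₁_oflipCM_mul, res₀_oflipCM_mul hcH hcen hc2 hx, hk, oflipCM_oflipCM_self]

omit [DecidablePred (· ∈ H)] in
/-- Hence **a transport face lies in any submodule containing the two-cycle face at its diagonal corner and the two mixed faces of the prism**
(the form used with the checklist of part IV). [folklore] -/
theorem transport_mem_of_mem (hc2 : c * c = 1) (x : G) (Θ : CMF G c) (k l : H) (N : Submodule ℤ (CMF G c →₀ ℤ))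
    (hq : gface c hc2 (oflipCM c hc2 (x * (k : G)) Θ) (l : G) (x * (l : G)) ∈ N)
    (h1 : gface c hc2 (oflipCM c hc2 (l : G) Θ) (l : G) (x * (k : G)) ∈ N)
    (h2 : gface c hc2 (oflipCM c hc2 (x * (l : G)) Θ) (l : G) (x * (k : G)) ∈ N) :
    gface c hc2 Θ (l : G) (x * (l : G)) ∈ N := by
  rw [transport_eq_twoCycle_sub_sub hc2 x Θ k l]
  exact Submodule.sub_mem _ (Submodule.sub_mem _ hq h1) h2

omit [DecidablePred (· ∈ H)] in
/-- Conversely **the two-cycle face at the diagonal corner lies in any submodule containing the transport and the two mixed faces.** [folklore] -/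
theorem twoCycle_mem_of_transport_mem (hc2 : c * c = 1) (x : G) (Θ : CMF G c) (k l : H) (N : Submodule ℤ (CMF G c →₀ ℤ))
    (hT : gface c hc2 Θ (l : G) (x * (l : G)) ∈ N)
    (h1 : gface c hc2 (oflipCM c hc2 (l : G) Θ) (l : G) (x * (k : G)) ∈ N)
    (h2 : gface c hc2 (oflipCM c hc2 (x * (l : G)) Θ) (l : G) (x * (k : G)) ∈ N) :
    gface c hc2 (oflipCM c hc2 (x * (k : G)) Θ) (l : G) (x * (l : G)) ∈ N := by
  rw [← gface_prism hc2 Θ (l : G) (x * (l : G)) (x * (k : G))]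
  exact Submodule.add_mem _ (Submodule.add_mem _ hT h1) h2

end

end Summit.HodgeConjecture.CorCM.Census.IndexTwoDescent
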